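import Summits.BirchSwinnertonDyer.BirchSwinnertonDyer.Theorems.Rank1ResidualX9JetchevCha
import Summits.BirchSwinnertonDyer.Rank1Residual.X11b.JetchevChaPairs1
import Summits.BirchSwinnertonDyer.Rank1Residual.Additive.IntModelTamagawaCertificateLocal
import Summits.BirchSwinnertonDyer.Rank1Residual.X11b.ChaPairsMinimality
import Summits.BirchSwinnertonDyer.Rank1Residual.X11b.CertificateCheckBridge
import Summits.BirchSwinnertonDyer.Rank1Residual.X11b.KrausMinimalityGeneralTwo
import Summits.BirchSwinnertonDyer.BirchSwinnertonDyer.Theorems.Rank1ResidualX11RankOneMinimality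
import Summits.BirchSwinnertonDyer.BirchSwinnertonDyer.Theorems.Rank1ResidualIntModelReduction
import Literature.NumberTheory.EllipticCurves.ComplexMultiplicationNotSemistable
import HarnessLib

/-!
# BSD rank-≤1, LITERAL row D5 `JET@p∣N` (cell `bsd-jet`, T1 road (C)): the KIT of the per-class
# Jetchev–Cha INDEX ≤ TAMAGAWA records — `BSD(E,p)` for a literal integer model from kernel-decidable
# model checks, ONE Frobenius witness (`E[p]` irreducible), ONE multiplicative prime (`E` non-CM), the
# published named facts and the per-pair two-engine certificate `ord_p [E(K):ℤy_K] ≤ ord_p c_q`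

HONEST FRAMING (programme `BSD-LIT2PART-PROGRAMME-v1.md` §HONESTY, verbatim): «no tranche here proves
BSD; ARM L moves the LITERAL column of an r ≤ 1 census into the kernel-proved-modulo-named-print
column; ARM P changes what «named print» is worth. The residue (4.31 %) and every SUMMIT-BEARING rung
(S0–S3) stay theorem-bound and are staffed by the 22 routes, not by this programme.» This file is a
TOOL: theorems only (no definition, no named fact, no `sorry`); PER PAIR; nothing is booked here;
nothing about any particular curve is asserted. Cell `bsd-jet` (run/shared/lean/pub/bsd-jet/), seat
`bsd-jet-ty` (typer), gen 0.

WHAT THIS FILE IS — the `JET` analogue of the b2b-bsdres x11c kit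
`X4.bsdp_prime_of_kolyvaginIndex_of_serreCounts[_support]` (`X4/KolyvaginIndexRecordsKitOddPrime.lean`,
p391900), with the Kolyvagin certificate line `p ∤ [E(K):ℤP]` replaced by the Jetchev–Cha line
`ord_p [E(K):ℤP] ≤ ord_p c_q` at ONE prime `q ∣ N` and the consumer swapped for the X9 prover's
class-free theorem `Rank1Residual.bsdp_of_millerJetchev_of_index_le_tamagawa`
(`Theorems/Rank1ResidualX9JetchevCha.lean`; binders `hMJ : Miller2011.thm54_cha_…` — Miller 2011
Thm. 5.4 = Jetchev's Tamagawa sharpening under Cha's hypotheses, FLAG `Miller11-Thm54-Cha-case`, whose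
own hypotheses are `p` odd, `p ∤ d_K`, `p² ∤ N`, `E` non-CM, `ρ̄_{E,p}` irreducible — and `hGZK`).
The two Galois-side hypotheses of the consumer are discharged IN THE KERNEL for a literal model, at ANY
odd prime `p` (so `p = 3`, three quarters of the JET population, is served by the same theorem):
  * `ρ̄_{E,p}` IRREDUCIBLE from ONE good prime `ℓ ∉ {2, p}` whose Frobenius polynomial
    `X² − a_ℓ X + ℓ`, `a_ℓ = ℓ + 1 − #Ẽ(𝔽_ℓ)`, has no root in `𝔽_p` (Mazur 1978 Prop. 6.3 (1); tree
    theorem `IntModel.hasIrreducibleModPGaloisRep_of_intModel_of_noroot`), the count being the schema's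
    kernel-evaluable `countPoints` (CORRECT: `X11b.natCard_point_eq_countPoints`);
  * `E` NON-CM from ONE prime `m` of multiplicative reduction, read off the minimal model as
    `m ∣ Δ`, `m ∤ c₄` (Silverman VII.5.1 (b); `IntModel.hasMultiplicativeReductionAtPrime_of_intModel`),
    since a CM curve over `ℚ` has no multiplicative prime (`j ∈ ℤ̄`; tree theorem
    `WeierstrassCurve.not_hasMultiplicativeReductionAtPrime_of_hasCM`) — on a `JET@p∣N` row with
    `p² ∤ N` the prime `m = p` itself always qualifies;
  * `IsElliptic` / `IsGloballyMinimal` of the literal model from `Δ ≠ 0` and the bounded Kraus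
    criterion (`X11RankOne.isGloballyMinimal_of_krausCriterion_bounded`) or, in the `_support` form,
    from the support of `Δ` (`X11b.isGloballyMinimal_of_krausCriterion_support`).
Every numeric hypothesis is a `decide` goal for a literal record; every other hypothesis is a
DISPLAYED binder of the record theorem, exactly as in every Heegner-index record of the tree: the
published facts `hMJ`, `hGZK`; the Heegner datum (`K` imaginary quadratic with the Heegner hypothesis
for the level `N`, `P = y_K` of infinite order, `p ∤ d_K`, `p² ∤ N`); the prime `q ∣ N`; the
CERTIFICATE LINE `hI : ord_p [E(K):ℤP] ≤ ord_p c_q` (two engines: the Heegner index `m = [E(K):ℤy_K]`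
by the Gross–Zagier value formula in Miller's normalisation, Miller 2011 Thm. 4.1 / Cor. 4.8, and an
independent re-derivation; `ord_p c_q` from Tate's algorithm on two engines — NEVER a kernel
computation); `r_an ≤ 1`; `#Ш_an = s` with `ord_p s = 0`. What such a record is worth (tier, flag) is
the referee's ruling, not this file's: the consumer's binder `hMJ` carries the flag
`Miller11-Thm54-Cha-case`, and at `p ∣ N` the register's `JET@p∣N` reading (Jetchev 2008 prints
Hypothesis (∗): `p ∤ N`, `ρ̄` onto; pub-bsdpct G28 / R185.6).

* `bsdp_of_jetIndexRow` — bounded-Kraus form (models with `|Δ| < 512¹²`).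
* `bsdp_of_jetIndexRow_support` — support form (no size bound on `Δ`).
* `bsdp_of_jetIndexRow_tam` / `bsdp_of_jetIndexRow_tam_support` (gen 0, v2 — the RECOMMENDED record shape):
  the prime `q` FIXED and the TAMAGAWA HALF of the certificate IN THE KERNEL — `c_q(W/ℚ_q) = c` from ONE
  `decide`-able stage-1 certificate `TamLocal` of the rank-2 observatory (Tate's algorithm: split `Iₙ` ⇒
  `c = n`; `Rank2ObservatoryTamagawaLocal.lean`) through the n1011-p03 bridge
  `Additive.IntModelTam.localTamagawaNumber_padic_eq_of_intModel_of_tamLocal` (p260470; transport theorem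
  `localTamagawaNumber_padic_eq_holds`, NO named fact), exactly as the tree's per-record precedent
  `X11b.bsdp_j<label>_tam` (`X11b/JetchevChaPairs3Tamagawa.lean`), and the Galois side through x11c's
  certificate shape `X11b.bsdp_of_ainvs_of_jetchevChaCertificate` (gen 4; multiplicative AT `p` —
  `p ∣ Δ`, `p ∤ c₄`, i.e. the `JET@p∣N` row has `p ∥ N` — gives non-CM; one Frobenius witness gives
  `E[p]` irreducible). What stays DISPLAYED is the pure Heegner-index line `hv : ord_p [E(K):ℤP] ≤ w`
  with `w ≤ ord_p c` a kernel numeral check — the two INDEX engines' datum and nothing else of the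
  certificate.

References: B. Mazur, *Rational isogenies of prime degree*, Invent. Math. 44 (1978) §5–6, Prop. 6.3 (1)
[Mazur1978]; R. L. Miller, LMS J. Comput. Math. 14 (2011) Def. 1.1, Thm. 4.1, Cor. 4.8, Thm. 5.4
[Miller2011LMS]; D. Jetchev, Compos. Math. 144 (2008) Thm. 1.4, Cor. 1.5 [Jetchev2008]; B. Cha,
J. Number Theory 111 (2005) Thm. 21 [Cha2005]; J. H. Silverman, *AEC* (2009) VII.1 Rem. 1.1,
VII.5 Prop. 5.1 (b), VIII.8 [SilvermanAEC2009]; J. H. Silverman, *Advanced Topics* (1994) II.6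
[SilvermanATAEC1994]; A. Kraus, Acta Arith. 54 (1989) Prop. 1–2 [Kraus1989].
-/

set_option autoImplicit false

noncomputable section

open scoped Classical

open WeierstrassCurve Literature.NumberTheory.EllipticCurves
  Literature.NumberTheory.EllipticCurves.Rank1Residual
  Literature.NumberTheory.EllipticCurves.Rank1Residual.X11RankOneCertificates
  Literature.NumberTheory.EllipticCurves.Miller2011
  Summit.BirchSwinnertonDyer.BirchSwinnertonDyer.Rank1Residual
  Summit.BirchSwinnertonDyer.BirchSwinnertonDyer.Rank1Residual.IntModel
  Summit.BirchSwinnertonDyer.BirchSwinnertonDyer.Rank1Residual.X11RankOne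
  Summit.BirchSwinnertonDyer.BirchSwinnertonDyer.Rank2Observatory.Tam

namespace Summit.BirchSwinnertonDyer.Rank1Residual.JET

/-- **`BSD(E,p)` at an odd prime `p` for a literal integer model from the Jetchev–Cha INDEX ≤ TAMAGAWA
certificate** (bounded-Kraus form). Inputs: (kernel, `decide` goals for a record) `Δ ≠ 0`,
`|Δ| < 512¹²` and the bounded Kraus disjunction below `512` (⇒ `IsElliptic`, `IsGloballyMinimal`);
ONE prime `ℓ ∉ {2, p}`, `ℓ ∤ Δ`, with `countPoints = n` and `X² − (ℓ + 1 − n)X + ℓ` without a root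
in `𝔽_p` (⇒ `ρ̄_{E,p}` irreducible, Mazur 1978 Prop. 6.3 (1)); ONE prime `m` with `m ∣ Δ`, `m ∤ c₄`
(multiplicative reduction at `m` ⇒ `E` non-CM); (binders, displayed) Miller 2011 Thm. 5.4 under Cha's
hypotheses `hMJ` (FLAG `Miller11-Thm54-Cha-case`), GZK `hGZK`, the Heegner datum `K`, `N`, `P` with
`p ∤ d_K`, `p² ∤ N`, a prime `q ∣ N` and the two-engine certificate line
`ord_p [E(K):ℤP] ≤ ord_p c_q`, `r_an ≤ 1`, `#Ш_an = s` with `ord_p s = 0`. Output: Miller's `BSD(E,p)`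
(`Rank1Residual.bsdp_of_millerJetchev_of_index_le_tamagawa`). Per pair; no class statement; nothing
about any particular curve is asserted. [cite: Miller2011LMS, Thm. 5.4 (arXiv:1010.2431 p. 11) and Def. 1.1]
[cite: Mazur1978, §6 Prop. 6.3 (1) (p. 153)] [cite: SilvermanAEC2009, VII.1 Remark 1.1 and VII.5 Prop. 5.1(b)]
[cite: SilvermanATAEC1994, Thm. II.6.4 (PDF p. 148)] -/
theorem bsdp_of_jetIndexRow (p : ℕ) (hp : p.Prime) (hp2 : p ≠ 2) (a1 a2 a3 a4 a6 : ℤ)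
    (h0 : discOf [a1, a2, a3, a4, a6] ≠ 0) (h512 : (discOf [a1, a2, a3, a4, a6]).natAbs < 512 ^ 12)
    (hKraus : ∀ q < 512, q < 2 ∨ ¬ q ^ 12 ∣ (discOf [a1, a2, a3, a4, a6]).natAbs ∨
      ¬ q ^ 4 ∣ (c4Of [a1, a2, a3, a4, a6]).natAbs ∨
      (q = 2 ∧ ¬ (2 : ℤ) ^ 8 ∣ c4Of [a1, a2, a3, a4, a6] ∧ (2 : ℤ) ^ 7 ∣ c6Of [a1, a2, a3, a4, a6]) ∨
      (q = 2 ∧ ¬ (2 : ℤ) ^ 24 ∣ discOf [a1, a2, a3, a4, a6] ∧ (512 : ℤ) ∣ c6Of [a1, a2, a3, a4, a6] ∧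
        (4 : ℤ) ∣ c6Of [a1, a2, a3, a4, a6] / 512 - 3) ∨
      (q = 3 ∧ (3 : ℤ) ^ 8 ∣ c6Of [a1, a2, a3, a4, a6] ∧ ¬ (3 : ℤ) ^ 9 ∣ c6Of [a1, a2, a3, a4, a6]))
    (ℓ : ℕ) (hℓ : ℓ.Prime) (h2ℓ : ℓ ≠ 2) (hℓp : ℓ ≠ p)
    (hΔℓ : ¬ (ℓ : ℤ) ∣ (⟨a1, a2, a3, a4, a6⟩ : WeierstrassCurve ℤ).Δ)
    {n : ℕ} (hc : countPoints [a1, a2, a3, a4, a6] ℓ = n)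
    (hnoroot : ∀ t : ZMod p, t ^ 2 - (((ℓ : ℤ) + 1 - n : ℤ) : ZMod p) * t + (ℓ : ZMod p) ≠ 0)
    (m : ℕ) (hm : m.Prime) (hmΔ : (m : ℤ) ∣ (⟨a1, a2, a3, a4, a6⟩ : WeierstrassCurve ℤ).Δ)
    (hmc₄ : ¬ (m : ℤ) ∣ (⟨a1, a2, a3, a4, a6⟩ : WeierstrassCurve ℤ).c₄)
    (hMJ : thm54_cha_padicValNat_shaOrder_add_tamagawa_le)
    (hGZK : rank_eq_analyticRank_of_analyticRank_le_one)
    (W : WeierstrassCurve ℚ) (hW : W = ⟨a1, a2, a3, a4, a6⟩)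
    {N : ℕ} [NeZero N] {K : Type} [Field K] [NumberField K] (hK : IsImaginaryQuadratic K)
    (hH : SatisfiesHeegnerHypothesis N K) {P : (W.baseChange K).toAffine.Point}
    (hP : IsHeegnerPoint N W K P) (hnt : ¬ IsOfFinAddOrder P)
    (hpD : ¬ (p : ℤ) ∣ NumberField.discr K) (hpN : ¬ p ^ 2 ∣ N)
    (q : ℕ) (hq : q.Prime) (hqN : q ∣ N)
    (hI : (haveI := Fact.mk hq;
      padicValNat p (AddSubgroup.zmultiples P).index ≤
        padicValNat p ((W.baseChange ℚ_[q]).localTamagawaNumber ℤ_[q])))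
    (hr : W.analyticRank ≤ 1) {s : ℚ} (hs : shaAn W = (s : ℂ)) (hv : padicValRat p s = 0) :
    BSDp W p := by
  subst hW
  haveI hE : (⟨a1, a2, a3, a4, a6⟩ : WeierstrassCurve ℚ).IsElliptic :=
    X11b.isElliptic_of_discOf_ne_zero a1 a2 a3 a4 a6 h0
  haveI hM : (⟨a1, a2, a3, a4, a6⟩ : WeierstrassCurve ℚ).IsGloballyMinimal :=
    isGloballyMinimal_of_krausCriterion_bounded a1 a2 a3 a4 a6 h0 h512 hKraus
  haveI : Fact (Nat.Prime p) := ⟨hp⟩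
  haveI := Fact.mk hℓ; haveI := Fact.mk hm; haveI := Fact.mk hq
  have hI0 : integralModelInt (⟨a1, a2, a3, a4, a6⟩ : WeierstrassCurve ℚ) = ⟨a1, a2, a3, a4, a6⟩ :=
    integralModelInt_eq_of_map_eq _ (map_mk_int a1 a2 a3 a4 a6)
  -- the witness count in `Nat.card` form (the schema's `countPoints` is CORRECT)
  have hn : Nat.card (((⟨a1, a2, a3, a4, a6⟩ : WeierstrassCurve ℤ).map
      (Int.castRingHom (ZMod ℓ))).toAffine.Point) = n := by
    exact_mod_cast (X11b.natCard_point_eq_countPoints a1 a2 a3 a4 a6 ℓ h2ℓ hΔℓ).trans hc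
  -- `ρ̄_{E,p}` irreducible (Mazur 1978 Prop. 6.3 (1))
  have hirr : Irr (⟨a1, a2, a3, a4, a6⟩ : WeierstrassCurve ℚ) p :=
    hasIrreducibleModPGaloisRep_of_intModel_of_noroot hI0 p ℓ hℓp hΔℓ hn hnoroot
  -- `E` non-CM: multiplicative reduction at `m`
  have hmult : (⟨a1, a2, a3, a4, a6⟩ : WeierstrassCurve ℚ).HasMultiplicativeReductionAtPrime m :=
    hasMultiplicativeReductionAtPrime_of_intModel hI0 m hmΔ hmc₄
  have hcm : ¬ (⟨a1, a2, a3, a4, a6⟩ : WeierstrassCurve ℚ).HasCM := fun hCM ↦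
    WeierstrassCurve.not_hasMultiplicativeReductionAtPrime_of_hasCM _ hCM m hmult
  exact bsdp_of_millerJetchev_of_index_le_tamagawa hMJ hGZK _ p hK hH hP hnt q hqN hcm hp2 hpD hpN
    hirr hI hr hs hv

/-- **`BSD(E,p)` at an odd prime `p` for a literal integer model from the Jetchev–Cha INDEX ≤ TAMAGAWA
certificate — SUPPORT form.** As `bsdp_of_jetIndexRow`, with global minimality from the support `bad`
of `Δ` (`|Δ| = ∏ q^{v_q Δ}`, each `q` prime) and the per-prime Kraus/Silverman test
(`X11b.isGloballyMinimal_of_krausCriterion_support`; no size bound on `Δ`). Per pair; no class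
statement. [cite: Miller2011LMS, Thm. 5.4 (arXiv:1010.2431 p. 11) and Def. 1.1]
[cite: Mazur1978, §6 Prop. 6.3 (1) (p. 153)] [cite: Kraus1989, Prop. 1 and Prop. 2]
[cite: SilvermanAEC2009, VII.1 Remark 1.1, VII.5 Prop. 5.1(b) and VIII.8] [cite: SilvermanATAEC1994, Thm. II.6.4 (PDF p. 148)] -/
theorem bsdp_of_jetIndexRow_support (p : ℕ) (hp : p.Prime) (hp2 : p ≠ 2) (a1 a2 a3 a4 a6 : ℤ)
    (h0 : discOf [a1, a2, a3, a4, a6] ≠ 0) (bad : List (ℕ × ℕ × ℕ)) (hprime : ∀ t ∈ bad, t.1.Prime)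
    (hsupp : (discOf [a1, a2, a3, a4, a6]).natAbs = (bad.map fun t => t.1 ^ t.2.2).prod)
    (hmin : ∀ t ∈ bad,
      (¬ (t.1 : ℤ) ^ 12 ∣ discOf [a1, a2, a3, a4, a6] ∨ ¬ (t.1 : ℤ) ^ 4 ∣ c4Of [a1, a2, a3, a4, a6]) ∨
      (t.1 = 2 ∧ (16 : ℤ) ∣ c4Of [a1, a2, a3, a4, a6] ∧ (64 : ℤ) ∣ c6Of [a1, a2, a3, a4, a6] ∧
        ¬ (((16 : ℤ) ∣ c4Of [a1, a2, a3, a4, a6] / 16 ∧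
            ((32 : ℤ) ∣ c6Of [a1, a2, a3, a4, a6] / 64 ∨ (32 : ℤ) ∣ c6Of [a1, a2, a3, a4, a6] / 64 - 8)) ∨
          (4 : ℤ) ∣ c6Of [a1, a2, a3, a4, a6] / 64 + 1)) ∨
      (t.1 = 3 ∧ (3 : ℤ) ^ 8 ∣ c6Of [a1, a2, a3, a4, a6] ∧ ¬ (3 : ℤ) ^ 9 ∣ c6Of [a1, a2, a3, a4, a6]))
    (ℓ : ℕ) (hℓ : ℓ.Prime) (h2ℓ : ℓ ≠ 2) (hℓp : ℓ ≠ p)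
    (hΔℓ : ¬ (ℓ : ℤ) ∣ (⟨a1, a2, a3, a4, a6⟩ : WeierstrassCurve ℤ).Δ)
    {n : ℕ} (hc : countPoints [a1, a2, a3, a4, a6] ℓ = n)
    (hnoroot : ∀ t : ZMod p, t ^ 2 - (((ℓ : ℤ) + 1 - n : ℤ) : ZMod p) * t + (ℓ : ZMod p) ≠ 0)
    (m : ℕ) (hm : m.Prime) (hmΔ : (m : ℤ) ∣ (⟨a1, a2, a3, a4, a6⟩ : WeierstrassCurve ℤ).Δ)
    (hmc₄ : ¬ (m : ℤ) ∣ (⟨a1, a2, a3, a4, a6⟩ : WeierstrassCurve ℤ).c₄)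
    (hMJ : thm54_cha_padicValNat_shaOrder_add_tamagawa_le)
    (hGZK : rank_eq_analyticRank_of_analyticRank_le_one)
    (W : WeierstrassCurve ℚ) (hW : W = ⟨a1, a2, a3, a4, a6⟩)
    {N : ℕ} [NeZero N] {K : Type} [Field K] [NumberField K] (hK : IsImaginaryQuadratic K)
    (hH : SatisfiesHeegnerHypothesis N K) {P : (W.baseChange K).toAffine.Point}
    (hP : IsHeegnerPoint N W K P) (hnt : ¬ IsOfFinAddOrder P)
    (hpD : ¬ (p : ℤ) ∣ NumberField.discr K) (hpN : ¬ p ^ 2 ∣ N)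
    (q : ℕ) (hq : q.Prime) (hqN : q ∣ N)
    (hI : (haveI := Fact.mk hq;
      padicValNat p (AddSubgroup.zmultiples P).index ≤
        padicValNat p ((W.baseChange ℚ_[q]).localTamagawaNumber ℤ_[q])))
    (hr : W.analyticRank ≤ 1) {s : ℚ} (hs : shaAn W = (s : ℂ)) (hv : padicValRat p s = 0) :
    BSDp W p := by
  subst hW
  haveI hE : (⟨a1, a2, a3, a4, a6⟩ : WeierstrassCurve ℚ).IsElliptic :=
    X11b.isElliptic_of_discOf_ne_zero a1 a2 a3 a4 a6 h0
  haveI hM : (⟨a1, a2, a3, a4, a6⟩ : WeierstrassCurve ℚ).IsGloballyMinimal :=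
    X11b.isGloballyMinimal_of_krausCriterion_support a1 a2 a3 a4 a6 bad hprime hsupp hmin
  haveI : Fact (Nat.Prime p) := ⟨hp⟩
  haveI := Fact.mk hℓ; haveI := Fact.mk hm; haveI := Fact.mk hq
  have hI0 : integralModelInt (⟨a1, a2, a3, a4, a6⟩ : WeierstrassCurve ℚ) = ⟨a1, a2, a3, a4, a6⟩ :=
    integralModelInt_eq_of_map_eq _ (map_mk_int a1 a2 a3 a4 a6)
  have hn : Nat.card (((⟨a1, a2, a3, a4, a6⟩ : WeierstrassCurve ℤ).map
      (Int.castRingHom (ZMod ℓ))).toAffine.Point) = n := by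
    exact_mod_cast (X11b.natCard_point_eq_countPoints a1 a2 a3 a4 a6 ℓ h2ℓ hΔℓ).trans hc
  have hirr : Irr (⟨a1, a2, a3, a4, a6⟩ : WeierstrassCurve ℚ) p :=
    hasIrreducibleModPGaloisRep_of_intModel_of_noroot hI0 p ℓ hℓp hΔℓ hn hnoroot
  have hmult : (⟨a1, a2, a3, a4, a6⟩ : WeierstrassCurve ℚ).HasMultiplicativeReductionAtPrime m :=
    hasMultiplicativeReductionAtPrime_of_intModel hI0 m hmΔ hmc₄
  have hcm : ¬ (⟨a1, a2, a3, a4, a6⟩ : WeierstrassCurve ℚ).HasCM := fun hCM ↦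
    WeierstrassCurve.not_hasMultiplicativeReductionAtPrime_of_hasCM _ hCM m hmult
  exact bsdp_of_millerJetchev_of_index_le_tamagawa hMJ hGZK _ p hK hH hP hnt q hqN hcm hp2 hpD hpN
    hirr hI hr hs hv

/-! ### v2 (recommended record shape): `q` fixed, the Tamagawa half in the kernel, `hv : ord_p [E(K):ℤP] ≤ w` displayed -/

/-- **`BSD(E,p)` at an odd prime `p ∥ N` for a literal integer model from the two-engine HEEGNER-INDEX line
`ord_p [E(K):ℤy_K] ≤ w`, with the Tamagawa exponent `w ≤ ord_p c_q(E)` CHECKED IN THE KERNEL** (bounded-Kraus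
form). Inputs: (kernel, `decide` goals for a record) `Δ ≠ 0`, `|Δ| < 512¹²`, the bounded Kraus disjunction
(⇒ `IsElliptic`, `IsGloballyMinimal`); `p ∣ Δ`, `p ∤ c₄` (multiplicative reduction AT `p` ⇒ non-CM; this is
the `p ∥ N` of a `JET@p∣N` row read off the minimal model); ONE prime `ℓ ∉ {2, p}`, `ℓ ∤ Δ`, with
`countPoints = n` and `X² − (ℓ + 1 − n)X + ℓ` root-free mod `p` (⇒ `E[p]` irreducible, Mazur 1978 Prop. 6.3 (1));
ONE stage-1 Tamagawa certificate `T : TamLocal` at the prime `q = T.p` with `T.check = true` and singleton value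
set `[c]` (⇒ `c_q(W/ℚ_q) = c`, Tate's algorithm, *ATAEC* IV.9.4; split `Iₙ`: `c = n = v_q(Δ)`), and
`w ≤ ord_p c`; (binders, displayed) `hMJ` (Miller 2011 Thm. 5.4 under Cha's hypotheses, FLAG
`Miller11-Thm54-Cha-case`; at `p ∣ N` the register's `JET@p∣N` reading), `hGZK`, the Heegner datum `K`, `N`,
`P` with `p ∤ d_K`, `p² ∤ N`, `q ∣ N`, the INDEX LINE `hv : ord_p [E(K):ℤP] ≤ w` (two engines: Gross–Zagier
value formula in Miller's normalisation, Thm. 4.1 / Cor. 4.8, and an independent re-derivation — never a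
kernel computation), `r_an ≤ 1`, `#Ш_an = s` with `ord_p s = 0`. Output: `BSD(E,p)` through x11c's shape
`X11b.bsdp_of_ainvs_of_jetchevChaCertificate` and n1011-p03's bridge
`Additive.IntModelTam.localTamagawaNumber_padic_eq_of_intModel_of_tamLocal`. Per pair; no class statement;
nothing about any particular curve is asserted. [cite: Miller2011LMS, Thm. 5.4 (arXiv:1010.2431 p. 11) and Def. 1.1]
[cite: Mazur1978, §6 Prop. 6.3 (1) (p. 153)] [cite: SilvermanATAEC1994, IV.9.4 and Cor. IV.9.2(d)]
[cite: SilvermanAEC2009, VII.1 Remark 1.1, VII.5 Prop. 5.1(b) and VII.6 Ex. 7.6] -/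
theorem bsdp_of_jetIndexRow_tam (p : ℕ) (hp : p.Prime) (hp2 : p ≠ 2) (a1 a2 a3 a4 a6 : ℤ)
    (h0 : discOf [a1, a2, a3, a4, a6] ≠ 0) (h512 : (discOf [a1, a2, a3, a4, a6]).natAbs < 512 ^ 12)
    (hKraus : ∀ q < 512, q < 2 ∨ ¬ q ^ 12 ∣ (discOf [a1, a2, a3, a4, a6]).natAbs ∨
      ¬ q ^ 4 ∣ (c4Of [a1, a2, a3, a4, a6]).natAbs ∨
      (q = 2 ∧ ¬ (2 : ℤ) ^ 8 ∣ c4Of [a1, a2, a3, a4, a6] ∧ (2 : ℤ) ^ 7 ∣ c6Of [a1, a2, a3, a4, a6]) ∨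
      (q = 2 ∧ ¬ (2 : ℤ) ^ 24 ∣ discOf [a1, a2, a3, a4, a6] ∧ (512 : ℤ) ∣ c6Of [a1, a2, a3, a4, a6] ∧
        (4 : ℤ) ∣ c6Of [a1, a2, a3, a4, a6] / 512 - 3) ∨
      (q = 3 ∧ (3 : ℤ) ^ 8 ∣ c6Of [a1, a2, a3, a4, a6] ∧ ¬ (3 : ℤ) ^ 9 ∣ c6Of [a1, a2, a3, a4, a6]))
    (hpΔ : (p : ℤ) ∣ discOf [a1, a2, a3, a4, a6]) (hpc4 : ¬ (p : ℤ) ∣ c4Of [a1, a2, a3, a4, a6])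
    (ℓ n : ℕ) (hℓ : ℓ.Prime) (h2ℓ : ℓ ≠ 2) (hℓp : ℓ ≠ p) (hℓΔ : ¬ (ℓ : ℤ) ∣ discOf [a1, a2, a3, a4, a6])
    (hc : countPoints [a1, a2, a3, a4, a6] ℓ = n)
    (hnoroot : ∀ t : ℕ, t < p → ¬ (p : ℤ) ∣ (t : ℤ) ^ 2 - ((ℓ : ℤ) + 1 - n) * t + ℓ)
    (q : ℕ) (T : TamLocal) (hTq : T.p = q) (hT : T.check ⟨a1, a2, a3, a4, a6⟩ = true)
    {c : ℕ} (hvals : T.vals = [c]) {w : ℕ} (hw : w ≤ padicValNat p c)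
    (hMJ : thm54_cha_padicValNat_shaOrder_add_tamagawa_le)
    (hGZK : rank_eq_analyticRank_of_analyticRank_le_one)
    (W : WeierstrassCurve ℚ) (hW : W = ⟨a1, a2, a3, a4, a6⟩)
    {N : ℕ} [NeZero N] {K : Type} [Field K] [NumberField K] (hK : IsImaginaryQuadratic K)
    (hH : SatisfiesHeegnerHypothesis N K) {P : (W.baseChange K).toAffine.Point}
    (hP : IsHeegnerPoint N W K P) (hnt : ¬ IsOfFinAddOrder P)
    (hpD : ¬ (p : ℤ) ∣ NumberField.discr K) (hpN : ¬ p ^ 2 ∣ N) (hqN : q ∣ N)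
    (hv : padicValNat p (AddSubgroup.zmultiples P).index ≤ w)
    (hr : W.analyticRank ≤ 1) {s : ℚ} (hs : shaAn W = (s : ℂ)) (hvs : padicValRat p s = 0) :
    BSDp W p := by
  subst hW
  haveI hE : (⟨a1, a2, a3, a4, a6⟩ : WeierstrassCurve ℚ).IsElliptic :=
    X11b.isElliptic_of_discOf_ne_zero a1 a2 a3 a4 a6 h0
  haveI hM : (⟨a1, a2, a3, a4, a6⟩ : WeierstrassCurve ℚ).IsGloballyMinimal :=
    isGloballyMinimal_of_krausCriterion_bounded a1 a2 a3 a4 a6 h0 h512 hKraus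
  haveI : Fact (Nat.Prime p) := ⟨hp⟩
  haveI := Fact.mk hℓ
  haveI : Fact (Nat.Prime q) := ⟨hTq ▸ (TamLocal.check_common hT).1⟩
  have hI0 : integralModelInt (⟨a1, a2, a3, a4, a6⟩ : WeierstrassCurve ℚ) = ⟨a1, a2, a3, a4, a6⟩ :=
    integralModelInt_eq_of_map_eq _ (map_mk_int a1 a2 a3 a4 a6)
  have hΔℓ : ¬ (ℓ : ℤ) ∣ (⟨a1, a2, a3, a4, a6⟩ : WeierstrassCurve ℤ).Δ := by
    rw [intCurve_Δ]; exact hℓΔ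
  -- the witness count in `Nat.card` form (the schema's `countPoints` is CORRECT)
  have hn : Nat.card (((⟨a1, a2, a3, a4, a6⟩ : WeierstrassCurve ℤ).map
      (Int.castRingHom (ZMod ℓ))).toAffine.Point) = n := by
    exact_mod_cast (X11b.natCard_point_eq_countPoints a1 a2 a3 a4 a6 ℓ h2ℓ hΔℓ).trans hc
  -- the Tamagawa half in the kernel: `c_q(W/ℚ_q) = c`
  have hcq : ((⟨a1, a2, a3, a4, a6⟩ : WeierstrassCurve ℚ).baseChange ℚ_[q]).localTamagawaNumber ℤ_[q] = c :=
    Additive.IntModelTam.localTamagawaNumber_padic_eq_of_intModel_of_tamLocal hI0 q hTq hT hvals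
  have hI : padicValNat p (AddSubgroup.zmultiples P).index ≤
      padicValNat p (((⟨a1, a2, a3, a4, a6⟩ : WeierstrassCurve ℚ).baseChange ℚ_[q]).localTamagawaNumber
        ℤ_[q]) := by
    rw [hcq]; exact hv.trans hw
  exact X11b.bsdp_of_ainvs_of_jetchevChaCertificate hMJ hGZK a1 a2 a3 a4 a6 hI0 p ℓ n hp2 hpΔ hpc4 hℓp
    hℓΔ hn hnoroot hK hH hP hnt hpD hpN q hqN hI hr hs hvs

/-- **`BSD(E,p)` at an odd prime `p ∥ N` from the two-engine HEEGNER-INDEX line with the Tamagawa half in the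
kernel — SUPPORT form** (global minimality from the support `bad` of `Δ` and the per-prime Kraus/Silverman
test, `X11b.isGloballyMinimal_of_krausCriterion_support`; no size bound on `Δ`). As
`bsdp_of_jetIndexRow_tam`. Per pair; no class statement. [cite: Miller2011LMS, Thm. 5.4 (arXiv:1010.2431 p. 11) and Def. 1.1]
[cite: Mazur1978, §6 Prop. 6.3 (1) (p. 153)] [cite: SilvermanATAEC1994, IV.9.4 and Cor. IV.9.2(d)]
[cite: Kraus1989, Prop. 1 and Prop. 2] [cite: SilvermanAEC2009, VII.1 Remark 1.1, VII.5 Prop. 5.1(b), VII.6 Ex. 7.6 and VIII.8] -/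
theorem bsdp_of_jetIndexRow_tam_support (p : ℕ) (hp : p.Prime) (hp2 : p ≠ 2) (a1 a2 a3 a4 a6 : ℤ)
    (h0 : discOf [a1, a2, a3, a4, a6] ≠ 0) (bad : List (ℕ × ℕ × ℕ)) (hprime : ∀ t ∈ bad, t.1.Prime)
    (hsupp : (discOf [a1, a2, a3, a4, a6]).natAbs = (bad.map fun t => t.1 ^ t.2.2).prod)
    (hmin : ∀ t ∈ bad,
      (¬ (t.1 : ℤ) ^ 12 ∣ discOf [a1, a2, a3, a4, a6] ∨ ¬ (t.1 : ℤ) ^ 4 ∣ c4Of [a1, a2, a3, a4, a6]) ∨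
      (t.1 = 2 ∧ (16 : ℤ) ∣ c4Of [a1, a2, a3, a4, a6] ∧ (64 : ℤ) ∣ c6Of [a1, a2, a3, a4, a6] ∧
        ¬ (((16 : ℤ) ∣ c4Of [a1, a2, a3, a4, a6] / 16 ∧
            ((32 : ℤ) ∣ c6Of [a1, a2, a3, a4, a6] / 64 ∨ (32 : ℤ) ∣ c6Of [a1, a2, a3, a4, a6] / 64 - 8)) ∨
          (4 : ℤ) ∣ c6Of [a1, a2, a3, a4, a6] / 64 + 1)) ∨
      (t.1 = 3 ∧ (3 : ℤ) ^ 8 ∣ c6Of [a1, a2, a3, a4, a6] ∧ ¬ (3 : ℤ) ^ 9 ∣ c6Of [a1, a2, a3, a4, a6]))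
    (hpΔ : (p : ℤ) ∣ discOf [a1, a2, a3, a4, a6]) (hpc4 : ¬ (p : ℤ) ∣ c4Of [a1, a2, a3, a4, a6])
    (ℓ n : ℕ) (hℓ : ℓ.Prime) (h2ℓ : ℓ ≠ 2) (hℓp : ℓ ≠ p) (hℓΔ : ¬ (ℓ : ℤ) ∣ discOf [a1, a2, a3, a4, a6])
    (hc : countPoints [a1, a2, a3, a4, a6] ℓ = n)
    (hnoroot : ∀ t : ℕ, t < p → ¬ (p : ℤ) ∣ (t : ℤ) ^ 2 - ((ℓ : ℤ) + 1 - n) * t + ℓ)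
    (q : ℕ) (T : TamLocal) (hTq : T.p = q) (hT : T.check ⟨a1, a2, a3, a4, a6⟩ = true)
    {c : ℕ} (hvals : T.vals = [c]) {w : ℕ} (hw : w ≤ padicValNat p c)
    (hMJ : thm54_cha_padicValNat_shaOrder_add_tamagawa_le)
    (hGZK : rank_eq_analyticRank_of_analyticRank_le_one)
    (W : WeierstrassCurve ℚ) (hW : W = ⟨a1, a2, a3, a4, a6⟩)
    {N : ℕ} [NeZero N] {K : Type} [Field K] [NumberField K] (hK : IsImaginaryQuadratic K)
    (hH : SatisfiesHeegnerHypothesis N K) {P : (W.baseChange K).toAffine.Point}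
    (hP : IsHeegnerPoint N W K P) (hnt : ¬ IsOfFinAddOrder P)
    (hpD : ¬ (p : ℤ) ∣ NumberField.discr K) (hpN : ¬ p ^ 2 ∣ N) (hqN : q ∣ N)
    (hv : padicValNat p (AddSubgroup.zmultiples P).index ≤ w)
    (hr : W.analyticRank ≤ 1) {s : ℚ} (hs : shaAn W = (s : ℂ)) (hvs : padicValRat p s = 0) :
    BSDp W p := by
  subst hW
  haveI hE : (⟨a1, a2, a3, a4, a6⟩ : WeierstrassCurve ℚ).IsElliptic :=
    X11b.isElliptic_of_discOf_ne_zero a1 a2 a3 a4 a6 h0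
  haveI hM : (⟨a1, a2, a3, a4, a6⟩ : WeierstrassCurve ℚ).IsGloballyMinimal :=
    X11b.isGloballyMinimal_of_krausCriterion_support a1 a2 a3 a4 a6 bad hprime hsupp hmin
  haveI : Fact (Nat.Prime p) := ⟨hp⟩
  haveI := Fact.mk hℓ
  haveI : Fact (Nat.Prime q) := ⟨hTq ▸ (TamLocal.check_common hT).1⟩
  have hI0 : integralModelInt (⟨a1, a2, a3, a4, a6⟩ : WeierstrassCurve ℚ) = ⟨a1, a2, a3, a4, a6⟩ :=
    integralModelInt_eq_of_map_eq _ (map_mk_int a1 a2 a3 a4 a6)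
  have hΔℓ : ¬ (ℓ : ℤ) ∣ (⟨a1, a2, a3, a4, a6⟩ : WeierstrassCurve ℤ).Δ := by
    rw [intCurve_Δ]; exact hℓΔ
  have hn : Nat.card (((⟨a1, a2, a3, a4, a6⟩ : WeierstrassCurve ℤ).map
      (Int.castRingHom (ZMod ℓ))).toAffine.Point) = n := by
    exact_mod_cast (X11b.natCard_point_eq_countPoints a1 a2 a3 a4 a6 ℓ h2ℓ hΔℓ).trans hc
  have hcq : ((⟨a1, a2, a3, a4, a6⟩ : WeierstrassCurve ℚ).baseChange ℚ_[q]).localTamagawaNumber ℤ_[q] = c :=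
    Additive.IntModelTam.localTamagawaNumber_padic_eq_of_intModel_of_tamLocal hI0 q hTq hT hvals
  have hI : padicValNat p (AddSubgroup.zmultiples P).index ≤
      padicValNat p (((⟨a1, a2, a3, a4, a6⟩ : WeierstrassCurve ℚ).baseChange ℚ_[q]).localTamagawaNumber
        ℤ_[q]) := by
    rw [hcq]; exact hv.trans hw
  exact X11b.bsdp_of_ainvs_of_jetchevChaCertificate hMJ hGZK a1 a2 a3 a4 a6 hI0 p ℓ n hp2 hpΔ hpc4 hℓp
    hℓΔ hn hnoroot hK hH hP hnt hpD hpN q hqN hI hr hs hvs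

end Summit.BirchSwinnertonDyer.Rank1Residual.JET

end
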